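import Summits.QuantumFields.YangMills.Theorems.BalabanLadderNTCeilingPricePackage
import Summits.QuantumFields.YangMills.Theorems.BalabanLadderNTReferenceMarginsExplicit
import HarnessLib

/-!
# Crux `NT` (stmt-QuantumFields-19353), stub `stub_refpkgT : RefPkgT`: the one-point ceiling prices the floors, V — the JOINT WINDOW
# prices the two-point oscillation constant: `C₂ ≤ 64 C₁² σ⁴ κ⁴ / δ⁸`

Helper file (`--supports stmt-QuantumFields-19353`) of the fleet lead prover of crux `NT` (unit `ym-spine-19353-p1`, GEN 12); sequel of
`…NTCeilingPricePackage` (collar law).  Hypothesis-free, general compact `G`, any `r`, any unit map `a > 0` with `a → 0`.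

On one reference torus the registered clause-4 inequality and the clause-1 cap read
`ε + 2C₁²(s/κ)⁸S_θS_v + C₂(s/κ)⁴ΣΣ|θv||v|/(1+‖y−x‖)⁴ ≤ Q2(θv,v) ≤ 4C₁²S_θS_v/R⁸`; the charged pairs are at most `2σ/s` apart
(both witnesses live in the ball of radius `σ`), so the E2 term is at least `C₂(s/κ)⁴S_θS_v/(1+2σ/s)⁴` and, with the SAME `S_θS_v` on
both sides, every envelope cancels again:

* `sum₂_kernel_ge` — `ΣΣ|θv(s x)||v(s y)|/(1+‖y−x‖)⁴ ≥ S_θS_v/(1+2σ/s)⁴`;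
* **`C₂_lt_of_clause4_at`** — at one coupling, on a collar-large reference torus (`2σ ≤ sL`, `4δ ≤ sL`, `3s < δ`, `2δ ≤ ℓ`):
  **`C₂ < 4C₁²κ⁴(s+2σ)⁴/(δ−3s)⁸`**;
* **`C₂_le_of_clause4`** — β-uniformly: **`C₂ ≤ 64 C₁² σ⁴ κ⁴/δ⁸`**: the two-point exterior-oscillation constant of clause 2 that a
  package may USE in its clause-4 margin is capped by the SQUARE of the one-point constant of clause 1 times the geometry `(2σκ/δ²)⁴`
  (consistent with g5's `kerCov_osc_of_e1osc`: E1-osc alone already forces a pair oscillation `8·8⁸C₁²/sep⁸`).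

HONEST FRAMING.  Real arithmetic and limits over the sequels; CONDITIONAL on clause 1; no floor, not AF, not NT, not the seam, not the gap;
not Clay.
-/

set_option autoImplicit false

noncomputable section

open scoped SchwartzMap
open MeasureTheory Filter Topology
open Literature.MathematicalPhysics.QuantumFieldTheory Literature.MathematicalPhysics.QuantumLattice
open Literature.Probability.LatticeModels
open Summit.QuantumFields.YangMills.Cruxes.OSLegsFromFemtoAndGap.DlrCollarTransfer
open Summit.QuantumFields.YangMills.Theorems.OSLegsFromFemtoAndGap (siteToE_sub)
open Summit.QuantumFields.YangMills.Cruxes.NT.Reference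
  (norm_siteToE_le_of_apply_ne_zero tsupport_thetaTest_subset_closedBall_zero)

namespace Summit.QuantumFields.YangMills.Cruxes.NT.CeilingPrice

/-! ## §1 The E2 term from below -/

/-- **The E2 kernel sum is at least `S_θS_v/(1+2σ/s)⁴`**: pairs charged by two witnesses supported in the ball of radius `σ`
(spacing `s > 0`) are at most `2σ/s` apart on the lattice. [folklore] -/
theorem sum₂_kernel_ge {v : 𝓢(EuclideanSpace ℝ (Fin 4), ℝ)} {σ s : ℝ} (hs : 0 < s)
    (hvσ : tsupport (v : EuclideanSpace ℝ (Fin 4) → ℝ) ⊆ Metric.closedBall 0 σ) (Λ : Finset (Fin 4 → ℤ)) :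
    (∑ x ∈ Λ, |thetaTest 4 v (s • siteToE x)|) * (∑ y ∈ Λ, |v (s • siteToE y)|) / (1 + 2 * σ / s) ^ 4 ≤
      ∑ x ∈ Λ, ∑ y ∈ Λ, |thetaTest 4 v (s • siteToE x)| * |v (s • siteToE y)| / (1 + ‖siteToE (y - x)‖) ^ 4 := by
  have hθσ := tsupport_thetaTest_subset_closedBall_zero hvσ
  rw [Finset.sum_mul_sum, Finset.sum_div]
  refine Finset.sum_le_sum fun x _ => ?_
  rw [Finset.sum_div]
  refine Finset.sum_le_sum fun y _ => ?_
  by_cases hx : thetaTest 4 v (s • siteToE x) = 0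
  · simp [hx]
  by_cases hy : v (s • siteToE y) = 0
  · simp [hy]
  have hX := norm_siteToE_le_of_apply_ne_zero hs hθσ hx
  have hY := norm_siteToE_le_of_apply_ne_zero hs hvσ hy
  have hdist : ‖siteToE (y - x)‖ ≤ 2 * σ / s := by
    rw [siteToE_sub]
    calc ‖siteToE y - siteToE x‖ ≤ ‖siteToE y‖ + ‖siteToE x‖ := norm_sub_le _ _
      _ ≤ σ / s + σ / s := add_le_add hY hX
      _ = 2 * σ / s := by ring
  have hpos : 0 < 1 + ‖siteToE (y - x)‖ := by positivity
  have hA : 0 ≤ |thetaTest 4 v (s • siteToE x)| * |v (s • siteToE y)| := by positivity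
  exact div_le_div_of_nonneg_left hA (pow_pos hpos 4) (pow_le_pow_left₀ hpos.le (by linarith) 4)

/-! ## §2 The window prices `C₂` -/

section Package

variable (G : Type) [Group G] [TopologicalSpace G] [IsTopologicalGroup G] [CompactSpace G]
  [MeasurableSpace G] [BorelSpace G] (r : LatticeRep G)

/-- **`C₂` is priced at one coupling.**  At coupling `β`, spacing `0 < s` with `3s < δ`: clause 1 (E1-osc, `C₁ ≥ 0`, range `ℓ ≥ 2δ`)
and the registered clause-4 floor-with-margin for a witness `v` (time gap `δ`, support in the ball of radius `σ ≥ 0`, `ε > 0`, `κ > 0`,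
`C₂ ≥ 0`) on a collar-large reference torus (`2σ ≤ sL`, `4δ ≤ sL`) force **`C₂ < 4C₁²κ⁴(s+2σ)⁴/(δ−3s)⁸`**. [folklore] -/
theorem C₂_lt_of_clause4_at (β : ℝ) {C₁ C₂ ℓ s κ : ℝ} (hC₁ : 0 ≤ C₁) (hC₂ : 0 ≤ C₂) (hκ : 0 < κ) (hs : 0 < s)
    (hE1 : ∀ (c : Fin 4 → ℤ) (b : ℕ), (b : ℝ) * s ≤ ℓ → ∀ (η η' : LGConfig 4 G) (x : Fin 4 → ℤ),
      1 ≤ depth c b x → |kerE G r β c b η (dens G r x) - kerE G r β c b η' (dens G r x)| ≤ C₁ / (depth c b x : ℝ) ^ 4)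
    {v : 𝓢(EuclideanSpace ℝ (Fin 4), ℝ)} {δ σ ε : ℝ} (hε : 0 < ε) (hσ : 0 ≤ σ) (h3 : 3 * s < δ) (hδℓ : 2 * δ ≤ ℓ)
    (hvδ : ∀ y : EuclideanSpace ℝ (Fin 4), v y ≠ 0 → δ ≤ y 0)
    (hvσ : tsupport (v : EuclideanSpace ℝ (Fin 4) → ℝ) ⊆ Metric.closedBall 0 σ) {L : ℕ} (hσL : 2 * σ ≤ s * L)
    (hδL : 4 * δ ≤ s * L)
    (hfloor : ε + 2 * (C₁ * (s / κ) ^ 4 * ∑ x ∈ box 4 L, |thetaTest 4 v (s • siteToE x)|) *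
          (C₁ * (s / κ) ^ 4 * ∑ y ∈ box 4 L, |v (s • siteToE y)|) +
        C₂ * (s / κ) ^ 4 * ∑ x ∈ box 4 L, ∑ y ∈ box 4 L,
          |thetaTest 4 v (s • siteToE x)| * |v (s • siteToE y)| / (1 + ‖siteToE (y - x)‖) ^ 4 ≤
      Q2 G r β L s (thetaTest 4 v) v) :
    C₂ < 4 * C₁ ^ 2 * κ ^ 4 * (s + 2 * σ) ^ 4 / (δ - 3 * s) ^ 8 := by
  obtain ⟨hR1, hR2, hR3, hR4⟩ := collarRadius_spec hs h3
  set R : ℕ := ⌊δ / s⌋₊ - 2 with hR_def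
  have hRpos : (0 : ℝ) < R := by exact_mod_cast hR1
  have hRℓ : ((2 * R + 3 : ℕ) : ℝ) * s ≤ ℓ := hR3.trans (by linarith)
  have hRL : 4 * R + 8 ≤ L := by
    have h1 : (4 * (R : ℝ) + 8) * s ≤ 4 * δ := by nlinarith
    have h2 : (4 * (R : ℝ) + 8) * s ≤ s * L := h1.trans hδL
    have h3' : (4 * (R : ℝ) + 8) ≤ L := by
      rw [mul_comm] at h2; exact le_of_mul_le_mul_left h2 hs
    exact_mod_cast h3'
  have hcap := abs_Q2_le_of_e1osc G r β hC₁ hs hE1 hvδ hvσ hσL hR1 hRℓ hRL hR2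
  set Sθ := ∑ x ∈ box 4 L, |thetaTest 4 v (s • siteToE x)| with hSθ
  set Sv := ∑ y ∈ box 4 L, |v (s • siteToE y)| with hSv
  have hSθ0 : 0 ≤ Sθ := Finset.sum_nonneg fun _ _ => abs_nonneg _
  have hSv0 : 0 ≤ Sv := Finset.sum_nonneg fun _ _ => abs_nonneg _
  have hlow := sum₂_kernel_ge (v := v) hs hvσ (box 4 L)
  set D : ℝ := (1 + 2 * σ / s) ^ 4 with hD
  have hD0 : 0 < D := by positivity
  set t : ℝ := (s / κ) ^ 4 with ht
  have ht0 : 0 < t := by positivity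
  have hkk : 0 ≤ 2 * (C₁ * t * Sθ) * (C₁ * t * Sv) := by positivity
  -- the window: `C₂ t SθSv/D < SθSv · 4C₁²/R⁸`
  have hwin : C₂ * t * (Sθ * Sv / D) < Sθ * Sv * (2 * C₁ / (R : ℝ) ^ 4) ^ 2 := by
    have h1 : C₂ * t * (Sθ * Sv / D) ≤ C₂ * t * ∑ x ∈ box 4 L, ∑ y ∈ box 4 L,
        |thetaTest 4 v (s • siteToE x)| * |v (s • siteToE y)| / (1 + ‖siteToE (y - x)‖) ^ 4 :=
      mul_le_mul_of_nonneg_left hlow (by positivity)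
    have h2 := (le_abs_self _).trans hcap
    linarith
  -- hence `SθSv > 0` and `C₂ t / D < 4C₁²/R⁸`
  have hP : 0 < Sθ * Sv := by
    rcases (mul_nonneg hSθ0 hSv0).lt_or_eq with h | h
    · exact h
    · exfalso; rw [← h] at hwin; simp at hwin
  have hkey : C₂ * t / D < 4 * C₁ ^ 2 / (R : ℝ) ^ 8 := by
    have e1 : C₂ * t * (Sθ * Sv / D) = (C₂ * t / D) * (Sθ * Sv) := by ring
    have e2 : Sθ * Sv * (2 * C₁ / (R : ℝ) ^ 4) ^ 2 = (4 * C₁ ^ 2 / (R : ℝ) ^ 8) * (Sθ * Sv) := by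
      field_simp; ring
    rw [e1, e2] at hwin
    exact lt_of_mul_lt_mul_right hwin hP.le
  -- unfold: `C₂ < 4C₁² D/(t R⁸) = 4C₁²κ⁴(s+2σ)⁴/(sR)⁸ ≤ 4C₁²κ⁴(s+2σ)⁴/(δ−3s)⁸`
  have h1 : C₂ < 4 * C₁ ^ 2 / (R : ℝ) ^ 8 * D / t := by
    rw [lt_div_iff₀ ht0]
    exact (div_lt_iff₀ hD0).1 hkey
  have e3 : 4 * C₁ ^ 2 / (R : ℝ) ^ 8 * D / t = 4 * C₁ ^ 2 * κ ^ 4 * (s + 2 * σ) ^ 4 / (s * R) ^ 8 := by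
    rw [hD, ht]
    field_simp
  rw [e3] at h1
  have hKK : 0 ≤ 4 * C₁ ^ 2 * κ ^ 4 * (s + 2 * σ) ^ 4 := by positivity
  exact h1.trans_le (div_le_div_of_nonneg_left hKK (pow_pos (by linarith) 8) (pow_le_pow_left₀ (by linarith) hR4 8))

/-- **`C₂` is priced, β-uniformly: `C₂ ≤ 64C₁²σ⁴κ⁴/δ⁸`.**  Let `a > 0`, `a → 0`; assume clause 1 of the registered package (`C₁ ≥ 0`,
range `ℓ`) and its clause 4 (`C₂ ≥ 0`, `κ > 0`, `ε > 0`) for a witness `v` with time gap `δ > 0` (`2δ ≤ ℓ`), support in the ball of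
radius `σ ≥ 0`, on collar-large reference tori (`2σ ≤ aβ·L₀β`, `4δ ≤ aβ·L₀β`).  Then `C₂ ≤ 4C₁²κ⁴(2σ)⁴/δ⁸ = 64C₁²σ⁴κ⁴/δ⁸`. [folklore] -/
theorem C₂_le_of_clause4 (a : ℝ → ℝ) (ha : ∀ β, 0 < a β) (ha0 : Tendsto a atTop (𝓝 0)) {C₁ C₂ ℓ κ : ℝ}
    (hC₁ : 0 ≤ C₁) (hC₂ : 0 ≤ C₂) (hκ : 0 < κ)
    (hE1 : ∃ β₁ : ℝ, ∀ β : ℝ, β₁ ≤ β → ∀ (c : Fin 4 → ℤ) (b : ℕ), (b : ℝ) * a β ≤ ℓ →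
      ∀ (η η' : LGConfig 4 G) (x : Fin 4 → ℤ), 1 ≤ depth c b x →
        |kerE G r β c b η (dens G r x) - kerE G r β c b η' (dens G r x)| ≤ C₁ / (depth c b x : ℝ) ^ 4)
    {v : 𝓢(EuclideanSpace ℝ (Fin 4), ℝ)} {δ σ ε : ℝ} (hε : 0 < ε) (hσ : 0 ≤ σ) (hδ : 0 < δ) (hδℓ : 2 * δ ≤ ℓ)
    (hvδ : ∀ y : EuclideanSpace ℝ (Fin 4), v y ≠ 0 → δ ≤ y 0)
    (hvσ : tsupport (v : EuclideanSpace ℝ (Fin 4) → ℝ) ⊆ Metric.closedBall 0 σ) {β₅ : ℝ} {L₀ : ℝ → ℕ}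
    (hL₀ : ∀ β : ℝ, β₅ ≤ β → 2 * σ ≤ a β * L₀ β ∧ 4 * δ ≤ a β * L₀ β)
    (hfloor : ∀ β : ℝ, β₅ ≤ β →
      ε + 2 * (C₁ * (a β / κ) ^ 4 * ∑ x ∈ box 4 (L₀ β), |thetaTest 4 v (a β • siteToE x)|) *
            (C₁ * (a β / κ) ^ 4 * ∑ y ∈ box 4 (L₀ β), |v (a β • siteToE y)|) +
          C₂ * (a β / κ) ^ 4 * ∑ x ∈ box 4 (L₀ β), ∑ y ∈ box 4 (L₀ β),
            |thetaTest 4 v (a β • siteToE x)| * |v (a β • siteToE y)| / (1 + ‖siteToE (y - x)‖) ^ 4 ≤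
        Q2 G r β (L₀ β) (a β) (thetaTest 4 v) v) :
    C₂ ≤ 4 * C₁ ^ 2 * κ ^ 4 * (2 * σ) ^ 4 / δ ^ 8 := by
  obtain ⟨β₁, H1⟩ := hE1
  have hev : ∀ᶠ β in atTop, C₂ < 4 * C₁ ^ 2 * κ ^ 4 * (a β + 2 * σ) ^ 4 / (δ - 3 * a β) ^ 8 := by
    have hsmall : ∀ᶠ β in atTop, a β < δ / 3 := ha0.eventually (gt_mem_nhds (by positivity))
    filter_upwards [hsmall, eventually_ge_atTop β₁, eventually_ge_atTop β₅] with β hβs hβ1 hβ5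
    have h3 : 3 * a β < δ := by linarith
    obtain ⟨hσL, hδL⟩ := hL₀ β hβ5
    exact C₂_lt_of_clause4_at G r β hC₁ hC₂ hκ (ha β) (H1 β hβ1) hε hσ h3 hδℓ hvδ hvσ hσL hδL (hfloor β hβ5)
  have hlim : Tendsto (fun β => 4 * C₁ ^ 2 * κ ^ 4 * (a β + 2 * σ) ^ 4 / (δ - 3 * a β) ^ 8) atTop
      (𝓝 (4 * C₁ ^ 2 * κ ^ 4 * (2 * σ) ^ 4 / δ ^ 8)) := by
    have hn : Tendsto (fun β => 4 * C₁ ^ 2 * κ ^ 4 * (a β + 2 * σ) ^ 4) atTop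
        (𝓝 (4 * C₁ ^ 2 * κ ^ 4 * (0 + 2 * σ) ^ 4)) := ((ha0.add tendsto_const_nhds).pow 4).const_mul _
    have hd : Tendsto (fun β => (δ - 3 * a β) ^ 8) atTop (𝓝 ((δ - 3 * 0) ^ 8)) :=
      (tendsto_const_nhds.sub (ha0.const_mul 3)).pow 8
    rw [zero_add] at hn
    rw [mul_zero, sub_zero] at hd
    exact hn.div hd (pow_ne_zero 8 hδ.ne')
  exact ge_of_tendsto hlim (hev.mono fun β hβ => hβ.le)

end Package

end Summit.QuantumFields.YangMills.Cruxes.NT.CeilingPrice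

end
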